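import Literature.AnabelianGeometry.SemiGraphs.TemperedMaximalCompactZorn
import Literature.AnabelianGeometry.SemiGraphs.TemperedPiCompactnessCriterion
import HarnessLib

/-!
# Maximal compact subgroups (Zorn) in the limit presentation `π₁^temp(𝒢) = lim_n Gal(𝒢_{∞,n}/𝒢)`

Mochizuki, *Semi-graphs of anabelioids*, Publ. RIMS **42** (2006), Prop. 3.6 (i) p. 38 (`π₁^temp(𝒢) :=
lim_n Gal(𝒢_{∞,n}/𝒢)`) and Thm. 3.7 (iv) p. 41 (maximal compact subgroups)
[cite: MochizukiSemiAnbd2006, Prop 3.6(i) p.38] [cite: MochizukiSemiAnbd2006, Thm 3.7(iv) p.41].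

PROOF-ONLY fourth part of `TemperedMaximalCompactZorn*.lean` (abc-iut cell, layer L3 frontier programme
«REFUTE-F1732», binder-form support for brick R7 / the (iv) seam; seat abc-iut-w6-d120; no definition): the
Zorn lemma in the CANONICAL LIMIT CURRENCY of abc-iut-L3-t2/t9/t10 (`CountableDiscreteSystem.limit`,
`GaloisLevelData.temperedPi h𝒢` with its level projections `proj n : π₁^temp →* Gal(𝒢_{∞,n}/𝒢)`), where NO
cofinality binder is needed — the compactness criterion is the tree's
`CountableDiscreteSystem.isCompact_of_isClosed_of_forall_finite_image` (closed with finite level images ⇒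
compact, `TemperedPiCompactnessCriterion.lean`):

* `exists_image_subset_of_isChain_of_continuous` — for a continuous homomorphism into a DISCRETE group whose
  finite subgroups have order `≤ B`, a nonempty chain of compact subgroups has ONE member whose image contains
  every member's image;
* `CountableDiscreteSystem.isCompact_closure_biUnion_of_isChain`, `….exists_isMaximalCompactSubgroup_ge` — in
  `lim_i G_i`, if the finite subgroups of each level `G_i` have bounded order (binder `hbd`), the closure of the
  union of a nonempty chain of compact subgroups is compact, hence (Zorn) every compact subgroup lies in a
  maximal compact subgroup;
* `ProfiniteSemiGraph.GaloisLevelData.exists_isMaximalCompactSubgroup_ge` — the same for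
  `π₁^temp(𝒢) = D.temperedPi h𝒢` with `hbd` on the level groups `Gal(𝒢_{∞,n}/𝒢)` (at a graph of finite level
  quotients with bounded vertex stabilisers — e.g. the countermodel candidate `𝒢_θ` — a finite subgroup fixes a
  tree vertex, so `hbd` holds), and `…exists_isMaximalCompactSubgroup` (`C = ⊥`).

HONEST FRAMING: nothing here bears on [IUTchIII] Cor. 3.12; no side taken; typed ≠ proved elsewhere.
-/

namespace Literature.AnabelianGeometry.SemiGraphs

open Topology
open scoped Pointwise

universe u v

/-! ### Chains of compact subgroups seen in a discrete quotient with bounded finite subgroups -/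

section Discrete

variable {G : Type u} [Group G] [TopologicalSpace G] {G' : Type v} [Group G'] [TopologicalSpace G']
  [DiscreteTopology G']

/-- **Bounded increasing unions of finite subgroups stabilise** (general form): for a continuous homomorphism
`f : G → G'` into a discrete group whose finite subgroups have order `≤ B`, a nonempty chain `c` of compact
subgroups of `G` has a member `K₀` with `f(K) ⊆ f(K₀)` for all `K ∈ c` (each `f(K)` is a finite subgroup; take
one of maximal order). [cite: MochizukiSemiAnbd2006, Thm 3.7(iv) p.41] -/
theorem exists_image_subset_of_isChain_of_continuous (f : G →* G') (hf : Continuous f) {B : ℕ}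
    (hB : ∀ H : Subgroup G', (H : Set G').Finite → Nat.card H ≤ B)
    {c : Set (Subgroup G)} (hc : IsChain (· ≤ ·) c) (hne : c.Nonempty)
    (hcpt : ∀ K ∈ c, IsCompact (K : Set G)) :
    ∃ K₀ ∈ c, ∀ K ∈ c, f '' (K : Set G) ⊆ f '' (K₀ : Set G) := by
  classical
  let φ : Subgroup G → ℕ := fun K => (f '' (K : Set G)).ncard
  have hfin : ∀ K ∈ c, (f '' (K : Set G)).Finite :=
    fun K hK => ((hcpt K hK).image hf).finite_of_discrete
  have hφB : ∀ K ∈ c, φ K ≤ B := by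
    intro K hK
    have hcoe : ((K.map f : Subgroup G') : Set G') = f '' (K : Set G) := by
      ext x; simp
    have h := hB (K.map f) (by rw [hcoe]; exact hfin K hK)
    have hcard : Nat.card (K.map f) = φ K := by
      change Nat.card ((K.map f : Subgroup G') : Set G') = _
      rw [hcoe, Nat.card_coe_set_eq]
    rw [← hcard]
    exact h
  obtain ⟨K₁, hK₁⟩ := hne
  -- the largest value of `φ` on `c` (bounded by `B`)
  let P : ℕ → Prop := fun m => ∃ K ∈ c, φ K = m
  let m := Nat.findGreatest P B
  have hPm : P m := Nat.findGreatest_spec (P := P) (hφB K₁ hK₁) ⟨K₁, hK₁, rfl⟩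
  have hmax : ∀ K ∈ c, φ K ≤ m := fun K hK => Nat.le_findGreatest (hφB K hK) ⟨K, hK, rfl⟩
  obtain ⟨K₀, hK₀, hφK₀⟩ := hPm
  refine ⟨K₀, hK₀, fun K hK => ?_⟩
  rcases hc.total hK hK₀ with hle | hle
  · exact Set.image_mono hle
  · have hsub : f '' (K₀ : Set G) ⊆ f '' (K : Set G) := Set.image_mono hle
    have hcard : (f '' (K : Set G)).ncard ≤ (f '' (K₀ : Set G)).ncard := by
      have := hmax K hK
      change φ K ≤ m at this
      rw [← hφK₀] at this
      exact this
    exact (Set.eq_of_subset_of_ncard_le hsub hcard (hfin K hK)).symm.subset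

/-- Under the same hypotheses, the image of the CLOSURE of the union of the chain is finite (contained in the
image of the maximal member: the target is discrete). [cite: MochizukiSemiAnbd2006, Thm 3.7(iv) p.41] -/
theorem finite_image_closure_biUnion_of_isChain (f : G →* G') (hf : Continuous f) {B : ℕ}
    (hB : ∀ H : Subgroup G', (H : Set G').Finite → Nat.card H ≤ B)
    {c : Set (Subgroup G)} (hc : IsChain (· ≤ ·) c) (hne : c.Nonempty)
    (hcpt : ∀ K ∈ c, IsCompact (K : Set G)) :
    (f '' closure (⋃ K ∈ c, (K : Set G))).Finite := by
  obtain ⟨K₀, hK₀, hsub⟩ := exists_image_subset_of_isChain_of_continuous f hf hB hc hne hcpt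
  have hfin₀ : (f '' (K₀ : Set G)).Finite := ((hcpt K₀ hK₀).image hf).finite_of_discrete
  refine hfin₀.subset ?_
  refine (image_closure_subset_closure_image hf).trans ?_
  rw [(isClosed_discrete _).closure_eq, Set.image_iUnion₂]
  exact Set.iUnion₂_subset fun K hK => hsub K hK

end Discrete

/-! ### The limit of countable discrete groups -/

namespace CountableDiscreteSystem

variable (S : CountableDiscreteSystem.{u})

/-- **In `lim_i G_i`, the closure of the union of a nonempty chain of compact subgroups is compact**, provided
the finite subgroups of every level `G_i` have bounded order (binder `hbd`): every level image of the closure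
is finite (`finite_image_closure_biUnion_of_isChain`), and a closed subset with finite level images is compact
(`isCompact_of_isClosed_of_forall_finite_image`). [cite: MochizukiSemiAnbd2006, Prop 3.6(i) p.38] -/
theorem isCompact_closure_biUnion_of_isChain
    (hbd : ∀ i : S.ι, ∃ B : ℕ, ∀ H : Subgroup (S.obj i), (H : Set (S.obj i)).Finite → Nat.card H ≤ B)
    {c : Set (Subgroup S.limit)} (hc : IsChain (· ≤ ·) c) (hne : c.Nonempty)
    (hcpt : ∀ K ∈ c, IsCompact (K : Set S.limit)) :
    IsCompact (closure (⋃ K ∈ c, (K : Set S.limit))) := by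
  refine S.isCompact_of_isClosed_of_forall_finite_image _ isClosed_closure fun i => ?_
  obtain ⟨B, hB⟩ := hbd i
  exact finite_image_closure_biUnion_of_isChain (S.proj i) (S.continuous_proj i) hB hc hne hcpt

/-- **Every compact subgroup of `lim_i G_i` lies in a maximal compact subgroup** (Zorn), provided the finite
subgroups of every level `G_i` have bounded order. [cite: MochizukiSemiAnbd2006, Thm 3.7(iv) p.41] -/
theorem exists_isMaximalCompactSubgroup_ge
    (hbd : ∀ i : S.ι, ∃ B : ℕ, ∀ H : Subgroup (S.obj i), (H : Set (S.obj i)).Finite → Nat.card H ≤ B)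
    (C : Subgroup S.limit) (hC : IsCompact (C : Set S.limit)) :
    ∃ K : Subgroup S.limit, IsMaximalCompactSubgroup K ∧ C ≤ K := by
  let T : Set (Subgroup S.limit) := {K | C ≤ K ∧ IsCompact (K : Set S.limit)}
  have hCT : C ∈ T := ⟨le_rfl, hC⟩
  have hchain : ∀ c ⊆ T, IsChain (· ≤ ·) c → ∀ y ∈ c, ∃ ub ∈ T, ∀ z ∈ c, z ≤ ub := by
    intro c hcT hc y hy
    have hne : c.Nonempty := ⟨y, hy⟩
    haveI : Nonempty c := hne.to_subtype
    have hcpt : ∀ K ∈ c, IsCompact (K : Set S.limit) := fun K hK => (hcT hK).2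
    let U : Subgroup S.limit := ⨆ K : c, (K : Subgroup S.limit)
    have hdir : Directed (· ≤ ·) (fun K : c => (K : Subgroup S.limit)) := hc.directedOn.directed_val
    have hUcoe : (U : Set S.limit) = ⋃ K ∈ c, (K : Set S.limit) := by
      rw [Subgroup.coe_iSup_of_directed hdir,
        ← Set.biUnion_eq_iUnion (s := c) (t := fun K _ => (K : Set S.limit))]
    have hleU : ∀ K ∈ c, K ≤ U := fun K hK => le_iSup (fun K : c => (K : Subgroup S.limit)) ⟨K, hK⟩
    refine ⟨U.topologicalClosure, ⟨?_, ?_⟩,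
      fun z hz => (hleU z hz).trans (Subgroup.le_topologicalClosure U)⟩
    · exact ((hcT hy).1.trans (hleU y hy)).trans (Subgroup.le_topologicalClosure U)
    · have h := S.isCompact_closure_biUnion_of_isChain hbd hc hne hcpt
      rw [← hUcoe] at h
      exact h
  obtain ⟨K, hCK, hKmax⟩ := zorn_le_nonempty₀ T hchain C hCT
  refine ⟨K, ⟨hKmax.1.2, fun K' hK' hKK' => ?_⟩, hCK⟩
  exact le_antisymm (hKmax.2 ⟨hCK.trans hKK', hK'⟩ hKK') hKK'

end CountableDiscreteSystem

/-! ### `π₁^temp(𝒢) = lim_n Gal(𝒢_{∞,n}/𝒢)` -/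

namespace ProfiniteSemiGraph

namespace GaloisLevelData

variable {𝒢 : ProfiniteSemiGraph.{u}} (D : GaloisLevelData 𝒢) (h𝒢 : 𝒢.IsCountable)

/-- **Every compact subgroup of `π₁^temp(𝒢)` lies in a maximal compact subgroup**, provided the finite subgroups
of every level group `Gal(𝒢_{∞,n}/𝒢)` have bounded order (binder `hbd`; holds when each level group acts on
the tree `𝔾̃_n` with vertex stabilisers of bounded order — a finite subgroup fixes a vertex or an edge,
`SemiGraph.ncard_le_of_finite_of_treeAction`).  No cofinality input: the topology of `π₁^temp` IS the limit
topology. [cite: MochizukiSemiAnbd2006, Thm 3.7(iv) p.41] -/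
theorem exists_isMaximalCompactSubgroup_ge
    (hbd : ∀ n : ℕ, ∃ B : ℕ, ∀ H : Subgroup (D.Gal h𝒢 n), (H : Set (D.Gal h𝒢 n)).Finite → Nat.card H ≤ B)
    (C : Subgroup (D.temperedPi h𝒢)) (hC : IsCompact (C : Set (D.temperedPi h𝒢))) :
    ∃ K : Subgroup (D.temperedPi h𝒢), IsMaximalCompactSubgroup K ∧ C ≤ K :=
  (D.system h𝒢).exists_isMaximalCompactSubgroup_ge (fun i => hbd i.down) C hC

/-- **Maximal compact subgroups of `π₁^temp(𝒢)` exist** under the same binder (`C = ⊥`).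
[cite: MochizukiSemiAnbd2006, Thm 3.7(iv) p.41] -/
theorem exists_isMaximalCompactSubgroup
    (hbd : ∀ n : ℕ, ∃ B : ℕ, ∀ H : Subgroup (D.Gal h𝒢 n), (H : Set (D.Gal h𝒢 n)).Finite → Nat.card H ≤ B) :
    ∃ K : Subgroup (D.temperedPi h𝒢), IsMaximalCompactSubgroup K := by
  obtain ⟨K, hK, -⟩ := D.exists_isMaximalCompactSubgroup_ge h𝒢 hbd ⊥
    (by rw [Subgroup.coe_bot]; exact isCompact_singleton)
  exact ⟨K, hK⟩

end GaloisLevelData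

end ProfiniteSemiGraph

end Literature.AnabelianGeometry.SemiGraphs
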